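import Mathlib
import HarnessLib
import Summits.QuantumFields.YangMills.Theses.PencilRigidity
import Literature.MathematicalPhysics.QuantumFieldTheory.OSReconstructionNoE1Proofs
import Summits.QuantumFields.YangMills.Theorems.PencilRigidityCurvatureKernelBoundKernelPinning
import Summits.QuantumFields.YangMills.Theorems.PencilRigidityCurvatureKernelBoundHalfSpaceKernelBumps
import Summits.QuantumFields.YangMills.Theorems.PencilRigidityCurvatureKernelBoundHalfSpaceKernelCluster
import Summits.QuantumFields.YangMills.Theorems.PencilRigidityCurvatureKernelBoundHalfSpaceKernelRiemann

/-!
# `CurvatureKernelBound` — stub H `HalfSpaceKernel`: local `L^∞`-type bound on one-point field vectors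

(support for stmt-QuantumFields-11687, line `sixteen-charts-analytic-kernel`, skeleton v11)

`integral_abs_le_of_tsupport_subset` and `norm_fieldVec_ofRealTest_sq_le`: the local two-point bound at height `p`
controls `‖Ψ_f‖` for real `f` supported in a small ball at any height `≥ p` (contraction semigroup + spatial
translation invariance). Headline (registered sub-goal): `LocalMassBound`.
-/

noncomputable section

open scoped BigOperators Topology SchwartzMap ComplexConjugate InnerProductSpace
open MeasureTheory Filter Set Metric
open Literature.MathematicalPhysics.QuantumLattice Literature.MathematicalPhysics.AQFT
open Literature.MathematicalPhysics.QuantumFieldTheory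
open Literature.MathematicalPhysics.QuantumLattice.SchwingerFamily (timeVec)

namespace Summit.QuantumFields.YangMills.Theorems.CurvatureKernel

section Identification

variable (ϖ : (EuclideanSpace ℝ (Fin 4)) → ℝ) (hϖc : Continuous ϖ) (hϖ0 : ∀ x, 0 ≤ ϖ x) (hϖ1 : ∀ x, ϖ x ≤ 1)
  (hϖsupp : tsupport ϖ ⊆ Metric.closedBall (0 : (EuclideanSpace ℝ (Fin 4))) 2)
  (hϖle : ∀ (N : ℕ) (y : (EuclideanSpace ℝ (Fin 4))), ∑ j ∈ Fintype.piFinset (fun _ : Fin 4 => Finset.Icc (-(N : ℤ)) N),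
    ϖ (y - WithLp.toLp 2 (fun i => ((j i : ℤ) : ℝ))) ≤ 1)
  (hϖeq : ∀ (N : ℕ) (y : (EuclideanSpace ℝ (Fin 4))), (∀ i : Fin 4, |y i| ≤ N) →
    ∑ j ∈ Fintype.piFinset (fun _ : Fin 4 => Finset.Icc (-(N : ℤ)) N), ϖ (y - WithLp.toLp 2 (fun i => ((j i : ℤ) : ℝ))) = 1)
  (hI : 0 < ∫ x, ϖ x)
  (b : ℕ → (EuclideanSpace ℝ (Fin 4)) → 𝓢(EuclideanSpace ℝ (Fin 4), ℝ))
  (hb : ∀ (n : ℕ) (c x : EuclideanSpace ℝ (Fin 4)), b n c x = ϖ ((((n : ℝ) + 2)) • (x - c)))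
  {S : SchwingerFamily (EuclideanSpace ℝ (Fin 4))} (h : OSReconstructionNoE1 S.toLabelled)
  (htr : (∀ (n : ℕ) (a : (EuclideanSpace ℝ (Fin 4))) (F : SchwartzMap (Fin n → (EuclideanSpace ℝ (Fin 4))) ℂ), IsOffDiagonal F → S n (translateMulti a F) = S n F))
  (𝒰 : Ultrafilter ℕ) (h𝒰 : (↑𝒰 : Filter ℕ) ≤ atTop)

/-- `∫ |g| ≤ M · vol B̄(c, ρ)` for `g` supported in `B̄(c, ρ)` with `|g| ≤ M`. [folklore] -/
theorem integral_abs_le_of_tsupport_subset (g : 𝓢(EuclideanSpace ℝ (Fin 4), ℝ)) (c : EuclideanSpace ℝ (Fin 4)) (ρ M : ℝ)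
    (hg : tsupport (g : EuclideanSpace ℝ (Fin 4) → ℝ) ⊆ Metric.closedBall c ρ) (hM : ∀ x, |g x| ≤ M) :
    ∫ x, |g x| ≤ M * (volume (Metric.closedBall c ρ)).toReal := by
  have hM0 : 0 ≤ M := (abs_nonneg _).trans (hM c)
  have hle : ∀ x, |g x| ≤ (Metric.closedBall c ρ).indicator (fun _ => M) x := by
    intro x
    by_cases hx : x ∈ Metric.closedBall c ρ
    · rw [Set.indicator_of_mem hx]; exact hM x
    · rw [Set.indicator_of_notMem hx, image_eq_zero_of_notMem_tsupport (fun h' => hx (hg h')), abs_zero]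
  calc ∫ x, |g x| ≤ ∫ x, (Metric.closedBall c ρ).indicator (fun _ => M) x := by
        refine integral_mono g.integrable.abs ?_ hle
        exact (integrable_indicator_iff measurableSet_closedBall).2 (integrableOn_const measure_closedBall_lt_top.ne)
    _ = M * (volume (Metric.closedBall c ρ)).toReal := by
        rw [integral_indicator measurableSet_closedBall, setIntegral_const, smul_eq_mul, mul_comm, Measure.real]

include htr in
/-- **Local `L^∞`-type bound on one-point field vectors at any height** (stub H): if the local two-point bound
holds at height `p` (radius `r₀`, constants `A, B`), then for a REAL test function `f` supported in a closed ball
`B̄(q, ρ)` with `ρ ≤ r₀`, `ρ < p ≤ q⁰` and `|f| ≤ M`, `‖Ψ_f‖² ≤ (A vol(B̄_ρ)² + B ρ⁸) M²`: shift `f` down to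
height `p` with the contraction `e^{-(q⁰−p)H}`, centre it on the time axis by spatial translation invariance, and
apply the local bound to the real tensor `(f''∘θ) ⊗ f''`. [folklore] -/
theorem norm_fieldVec_ofRealTest_sq_le (p r₀ A B : ℝ) (hA : 0 ≤ A)
    (hLB : (∀ (r : ℝ), 0 < r → r ≤ r₀ → ∀ (f : Fin 2 → SchwartzMap (EuclideanSpace ℝ (Fin 4)) ℝ) (F : SchwartzMap (Fin 2 → (EuclideanSpace ℝ (Fin 4))) ℂ) (M₀ M₁ : ℝ), IsTensorOf F (fun i => ofRealTest (f i)) → tsupport ((f 0 : SchwartzMap (EuclideanSpace ℝ (Fin 4)) ℝ) : (EuclideanSpace ℝ (Fin 4)) → ℝ) ⊆ Metric.closedBall (EuclideanSpace.single (0 : Fin 4) (-p)) r → tsupport ((f 1 : SchwartzMap (EuclideanSpace ℝ (Fin 4)) ℝ) : (EuclideanSpace ℝ (Fin 4)) → ℝ) ⊆ Metric.closedBall (EuclideanSpace.single (0 : Fin 4) p) r → (∀ x, |f 0 x| ≤ M₀) → (∀ x, |f 1 x| ≤ M₁) → ‖S 2 F‖ ≤ A * (∫ x : (EuclideanSpace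 ℝ (Fin 4)), |f 0 x|) * (∫ x : (EuclideanSpace ℝ (Fin 4)), |f 1 x|) + B * r ^ 8 * M₀ * M₁))
    (q : EuclideanSpace ℝ (Fin 4)) (ρ : ℝ) (hρ : 0 < ρ) (hρr : ρ ≤ r₀) (hρp : ρ < p) (hq : p ≤ q 0)
    (f : 𝓢(EuclideanSpace ℝ (Fin 4), ℝ)) (hf : tsupport (f : EuclideanSpace ℝ (Fin 4) → ℝ) ⊆ Metric.closedBall q ρ)
    (M : ℝ) (hM : ∀ x, |f x| ≤ M)
    (hfpos : tsupport ((ofRealTest f : 𝓢(EuclideanSpace ℝ (Fin 4), ℂ)) : EuclideanSpace ℝ (Fin 4) → ℂ) ⊆ {y | 0 < y 0}) :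
    ‖h.fieldVec 1 (fun _ => ()) _ (isTimeOrdered_tensorFin_one hfpos)‖ ^ 2 ≤
      (A * (volume (Metric.closedBall q ρ)).toReal ^ 2 + B * ρ ^ 8) * M ^ 2 := by
  -- ### geometry: the time shift `τ = q⁰ − p ≥ 0` and the spatial part `a = q⃗`
  set τ : ℝ := q 0 - p with hτ
  have hτ0 : 0 ≤ τ := by rw [hτ]; linarith
  set eτ : EuclideanSpace ℝ (Fin 4) := EuclideanSpace.single 0 τ with heτ
  have heτ0 : eτ 0 = τ := by simp [heτ]
  set a : EuclideanSpace ℝ (Fin 4) := spatialPart 0 q with ha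
  have ha0 : a 0 = 0 := by simp [ha, spatialPart_apply]
  have hθa : timeReflection 4 a = a := OSReconstructionNoE1.timeReflection_of_apply_zero ha0
  set cP : EuclideanSpace ℝ (Fin 4) := EuclideanSpace.single 0 p with hcP
  set cM : EuclideanSpace ℝ (Fin 4) := EuclideanSpace.single 0 (-p) with hcM
  have hqdec : q = cP + eτ + a := by
    have h1 := timeVec_add_spatialPart_eq q
    have h2 : (timeVec (q 0) : EuclideanSpace ℝ (Fin 4)) = cP + eτ := by
      ext i; by_cases hi : i = 0 <;> simp [timeVec, heτ, hcP, hi, hτ]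
    rw [← h1, h2]
  have hθc : timeReflection 4 cP = cM := by
    ext i; by_cases hi : i = 0 <;> simp [timeReflection_apply, hcP, hcM, hi]
  -- translated supports
  have htrans : ∀ (g : 𝓢(EuclideanSpace ℝ (Fin 4), ℝ)) (v c : EuclideanSpace ℝ (Fin 4)) (r : ℝ),
      tsupport (g : EuclideanSpace ℝ (Fin 4) → ℝ) ⊆ Metric.closedBall c r →
      tsupport ((SchwartzMap.compSubConstCLM ℝ (-v) g : 𝓢(EuclideanSpace ℝ (Fin 4), ℝ)) : EuclideanSpace ℝ (Fin 4) → ℝ) ⊆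
        Metric.closedBall (c - v) r := by
    intro g v c r hg x hx
    have hfun : ((SchwartzMap.compSubConstCLM ℝ (-v) g : 𝓢(EuclideanSpace ℝ (Fin 4), ℝ)) : EuclideanSpace ℝ (Fin 4) → ℝ) =
        (g : EuclideanSpace ℝ (Fin 4) → ℝ) ∘ fun x => x + v := by
      funext y; simp [SchwartzMap.compSubConstCLM_apply]
    rw [hfun] at hx
    have hx' := hg (tsupport_comp_subset_preimage (g : EuclideanSpace ℝ (Fin 4) → ℝ) (continuous_add_const _) hx)
    have hx'' : (x + v) ∈ Metric.closedBall c r := hx'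
    rw [Metric.mem_closedBall, dist_eq_norm] at hx''
    rw [Metric.mem_closedBall, dist_eq_norm]
    convert hx'' using 2; abel
  -- ### the shifted functions `f' = f(· + τe₀)` and `f'' = f'(· + a)`
  set f' : 𝓢(EuclideanSpace ℝ (Fin 4), ℝ) := SchwartzMap.compSubConstCLM ℝ (-eτ) f with hf'
  set f'' : 𝓢(EuclideanSpace ℝ (Fin 4), ℝ) := SchwartzMap.compSubConstCLM ℝ (-a) f' with hf''
  have hf'_apply : ∀ x, f' x = f (x + eτ) := fun x => by simp [hf', SchwartzMap.compSubConstCLM_apply]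
  have hf''_apply : ∀ x, f'' x = f' (x + a) := fun x => by simp [hf'', SchwartzMap.compSubConstCLM_apply]
  have hf'supp : tsupport (f' : EuclideanSpace ℝ (Fin 4) → ℝ) ⊆ Metric.closedBall (cP + a) ρ := by
    have := htrans f eτ q ρ hf
    rw [hqdec, show cP + eτ + a - eτ = cP + a by abel] at this
    exact this
  have hf''supp : tsupport (f'' : EuclideanSpace ℝ (Fin 4) → ℝ) ⊆ Metric.closedBall cP ρ := by
    have := htrans f' a (cP + a) ρ hf'supp
    rwa [add_sub_cancel_right] at this
  have hθf''supp : tsupport ((thetaTest 4 f'' : 𝓢(EuclideanSpace ℝ (Fin 4), ℝ)) : EuclideanSpace ℝ (Fin 4) → ℝ) ⊆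
      Metric.closedBall cM ρ := by
    intro x hx
    have hfun : ((thetaTest 4 f'' : 𝓢(EuclideanSpace ℝ (Fin 4), ℝ)) : EuclideanSpace ℝ (Fin 4) → ℝ) =
        (f'' : EuclideanSpace ℝ (Fin 4) → ℝ) ∘ timeReflection 4 := by
      funext y; simp [thetaTest_apply]
    rw [hfun] at hx
    have hx' := hf''supp (tsupport_comp_subset_preimage (f'' : EuclideanSpace ℝ (Fin 4) → ℝ) (timeReflection 4).continuous hx)
    have hx'' : timeReflection 4 x ∈ Metric.closedBall cP ρ := hx'
    rw [Metric.mem_closedBall] at hx''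
    rw [Metric.mem_closedBall, ← hθc, ← LinearIsometryEquiv.dist_map (timeReflection 4) x, timeReflection_timeReflection]
    exact hx''
  -- positivity of `f'`
  have hf'pos : tsupport ((ofRealTest f' : 𝓢(EuclideanSpace ℝ (Fin 4), ℂ)) : EuclideanSpace ℝ (Fin 4) → ℂ) ⊆ {y | 0 < y 0} := by
    intro y hy
    have hy' := hf'supp ((tsupport_comp_subset (g := fun r : ℝ => (r : ℂ)) Complex.ofReal_zero _) hy)
    rw [Metric.mem_closedBall, dist_eq_norm] at hy'
    have h1 : |(y - (cP + a)) 0| ≤ ‖y - (cP + a)‖ := by simpa using PiLp.norm_apply_le (p := 2) (y - (cP + a)) 0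
    rw [PiLp.sub_apply, PiLp.add_apply, ha0, abs_le] at h1
    have : cP 0 = p := by simp [hcP]
    show 0 < y 0
    linarith [h1.1]
  -- bounds
  have hMf' : ∀ x, |f' x| ≤ M := fun x => by rw [hf'_apply]; exact hM _
  have hMf'' : ∀ x, |f'' x| ≤ M := fun x => by rw [hf''_apply]; exact hMf' _
  have hMθf'' : ∀ x, |(thetaTest 4 f'' : 𝓢(EuclideanSpace ℝ (Fin 4), ℝ)) x| ≤ M := fun x => by
    rw [thetaTest_apply]; exact hMf'' _
  have hM0 : 0 ≤ M := (abs_nonneg _).trans (hM q)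
  -- ### step 1: shift down in time with the contraction semigroup
  have hshift : h.fieldVec 1 (fun _ => ()) _ (isTimeOrdered_tensorFin_one hfpos) =
      h.transfer (eτ 0) (h.translate eτ (h.fieldVec 1 (fun _ => ()) _ (isTimeOrdered_tensorFin_one hf'pos))) := by
    have hcomp : SchwartzMap.compSubConstCLM ℂ eτ (ofRealTest f') = ofRealTest f := by
      ext x
      simp [SchwartzMap.compSubConstCLM_apply, ofRealTest_apply, hf'_apply]
    have hpos2 : tsupport ((SchwartzMap.compSubConstCLM ℂ eτ (ofRealTest f') : 𝓢(EuclideanSpace ℝ (Fin 4), ℂ)) :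
        EuclideanSpace ℝ (Fin 4) → ℂ) ⊆ {y | 0 < y 0} := by rw [hcomp]; exact hfpos
    rw [transfer_translate_fieldVec_one h hf'pos (by rw [heτ0]; exact hτ0) hpos2]
    exact fieldVec_one_congr h (by rw [hcomp]) _ _
  have hle1 : ‖h.fieldVec 1 (fun _ => ()) _ (isTimeOrdered_tensorFin_one hfpos)‖ ≤
      ‖h.fieldVec 1 (fun _ => ()) _ (isTimeOrdered_tensorFin_one hf'pos)‖ := by
    rw [hshift]
    refine (h.norm_transfer_le _ _).trans ?_
    rw [LinearIsometryEquiv.norm_map]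
  -- ### step 2: the norm of `Ψ_{f'}` as a two-point value, centred on the axis by spatial invariance
  set G : 𝓢((Fin 2 → EuclideanSpace ℝ (Fin 4)), ℂ) := SchwartzMap.tensorFin 2 ![ofRealTest (thetaTest 4 f''), ofRealTest f''] with hG
  have hGoff : IsOffDiagonal G := by
    refine isOffDiagonal_tensorFin_two_of_disjoint ?_
    refine Set.disjoint_of_subset
      ((tsupport_comp_subset (g := fun r : ℝ => (r : ℂ)) Complex.ofReal_zero _).trans hθf''supp)
      ((tsupport_comp_subset (g := fun r : ℝ => (r : ℂ)) Complex.ofReal_zero _).trans hf''supp) ?_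
    refine Metric.closedBall_disjoint_closedBall ?_
    have : dist cM cP = 2 * p := by
      have e : cM - cP = EuclideanSpace.single (0 : Fin 4) (-(2 * p)) := by
        ext i; by_cases hi : i = 0 <;> simp [hcM, hcP, hi]; ring
      rw [dist_eq_norm, e, PiLp.norm_single, norm_neg, Real.norm_of_nonneg (by linarith)]
    rw [this]; linarith
  have htensor : SchwartzMap.tensorFin 2 ![starTest (thetaTest 4 (ofRealTest f')), ofRealTest f'] = translateMulti a G := by
    rw [starTest_thetaTest_ofRealTest, hG, translateMulti_tensorFin_two]
    congr 1
    ext i x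
    fin_cases i
    · simp [SchwartzMap.compSubConstCLM_apply, ofRealTest_apply, thetaTest_apply, hf''_apply, map_sub, hθa]
    · simp [SchwartzMap.compSubConstCLM_apply, ofRealTest_apply, hf''_apply]
  have hnorm' : ‖h.fieldVec 1 (fun _ => ()) _ (isTimeOrdered_tensorFin_one hf'pos)‖ ^ 2 ≤ ‖S 2 G‖ := by
    rw [norm_fieldVec_one_sq h hf'pos, htensor, htr 2 a G hGoff]
    exact Complex.re_le_norm _
  -- ### step 3: the local bound on `G`
  set fv : Fin 2 → 𝓢(EuclideanSpace ℝ (Fin 4), ℝ) := ![thetaTest 4 f'', f''] with hfv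
  have hGt : IsTensorOf G (fun i => ofRealTest (fv i)) := by
    have := isTensorOf_tensorFin_two_ofRealTest (thetaTest 4 f'') f''
    simpa [hG, hfv] using this
  have hvolp : (volume (Metric.closedBall cP ρ)).toReal = (volume (Metric.closedBall q ρ)).toReal := by
    rw [Measure.addHaar_closedBall_center, Measure.addHaar_closedBall_center volume q]
  have hvolm : (volume (Metric.closedBall cM ρ)).toReal = (volume (Metric.closedBall q ρ)).toReal := by
    rw [Measure.addHaar_closedBall_center, Measure.addHaar_closedBall_center volume q]
  have hI0 : ∫ x, |(fv 0) x| ≤ M * (volume (Metric.closedBall q ρ)).toReal := by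
    have := integral_abs_le_of_tsupport_subset (thetaTest 4 f'') _ ρ M hθf''supp hMθf''
    rw [hvolm] at this; simpa [hfv] using this
  have hI1 : ∫ x, |(fv 1) x| ≤ M * (volume (Metric.closedBall q ρ)).toReal := by
    have := integral_abs_le_of_tsupport_subset f'' _ ρ M hf''supp hMf''
    rw [hvolp] at this; simpa [hfv] using this
  have hInn0 : 0 ≤ ∫ x, |(fv 0) x| := integral_nonneg fun _ => abs_nonneg _
  have hInn1 : 0 ≤ ∫ x, |(fv 1) x| := integral_nonneg fun _ => abs_nonneg _
  have hLBG : ‖S 2 G‖ ≤ A * (∫ x, |(fv 0) x|) * (∫ x, |(fv 1) x|) + B * ρ ^ 8 * M * M :=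
    hLB ρ hρ hρr fv G M M hGt (by simpa [hfv] using hθf''supp) (by simpa [hfv] using hf''supp)
      (by simpa [hfv] using hMθf'') (by simpa [hfv] using hMf'')
  -- ### assembly
  set V : ℝ := (volume (Metric.closedBall q ρ)).toReal with hV
  have hV0 : 0 ≤ V := ENNReal.toReal_nonneg
  calc ‖h.fieldVec 1 (fun _ => ()) _ (isTimeOrdered_tensorFin_one hfpos)‖ ^ 2
      ≤ ‖h.fieldVec 1 (fun _ => ()) _ (isTimeOrdered_tensorFin_one hf'pos)‖ ^ 2 := pow_le_pow_left₀ (norm_nonneg _) hle1 2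
    _ ≤ ‖S 2 G‖ := hnorm'
    _ ≤ A * (∫ x, |(fv 0) x|) * (∫ x, |(fv 1) x|) + B * ρ ^ 8 * M * M := hLBG
    _ ≤ A * (M * V) * (M * V) + B * ρ ^ 8 * M * M := by
        have h1 : (∫ x, |(fv 0) x|) * (∫ x, |(fv 1) x|) ≤ (M * V) * (M * V) :=
          mul_le_mul hI0 hI1 hInn1 (by positivity)
        nlinarith [mul_le_mul_of_nonneg_left h1 hA]
    _ = (A * V ^ 2 + B * ρ ^ 8) * M ^ 2 := by ring

end Identification

/-- **Sub-goal `LocalMassBound`** (helper-file headline for stub `HalfSpaceKernel`; registered signature): the mass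
of a function supported in a closed ball is at most its sup times the volume of the ball. [folklore] -/
theorem LocalMassBound : ∀ (g : SchwartzMap (EuclideanSpace ℝ (Fin 4)) ℝ) (c : EuclideanSpace ℝ (Fin 4)) (ρ M : ℝ), tsupport (g : EuclideanSpace ℝ (Fin 4) → ℝ) ⊆ Metric.closedBall c ρ → (∀ x, |g x| ≤ M) → ∫ x, |g x| ≤ M * (MeasureTheory.volume (Metric.closedBall c ρ)).toReal := by
  intro g c ρ M hg hM
  exact integral_abs_le_of_tsupport_subset g c ρ M hg hM

end Summit.QuantumFields.YangMills.Theorems.CurvatureKernel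

end
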